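import Literature.Analysis.FluidPDE.BiotSavartGradient

/-! # Gradient of the Biot–Savart velocity at the centre of a vorticity-free ball — crux stmt-NavierStokesRegularity-11291 (`CoreLogGas.BlowupIsLocallyDriven`), line registered, stub stub_farSupportGrad

Registered stub `stub_farSupportGrad` (`--supports stmt-NavierStokesRegularity-11291`) of the
line `registered` of the crux `CoreLogGas.BlowupIsLocallyDriven`: if an integrable field
`F : ℝ³ → ℝ³` vanishes on the ball `B(x, δ)`, then its Biot–Savart velocity
`biotSavart F = K₃ ∗ F` is differentiable at the centre `x`, and
`‖∇(biotSavart F)(x)‖ ≤ A δ⁻³ ∫ ‖F‖` with an absolute constant `A`.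

Proof. Let `K_ε = truncKernel biotSavartCLM ε` be the tree's smoothly truncated Biot–Savart
kernel (`SingularKernelTruncation.lean`; Gilbarg–Trudinger §4.1): `C¹` on all of `ℝ³`, equal to
`K₃` on `|z| ≥ 2ε`, with `‖K_ε‖ ≤ A ε⁻²` and `‖∇K_ε‖ ≤ A(1 + 2B) ε⁻³` uniformly. With `ε = δ/4`,
for `z ∈ B(x, δ/2)` and every `y` either `F y = 0` (if `y ∈ B(x, δ)`) or `|z − y| ≥ δ/2 = 2ε`, so
`biotSavart F = ∫ K_ε(· − y) F(y) dy` on the neighbourhood `B(x, δ/2)` of `x`. The regularised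
potential of an integrable density is differentiable with derivative under the integral sign
(dominated differentiation, Mathlib `hasFDerivAt_integral_of_dominated_of_fderiv_le`; the tree's
`hasFDerivAt_truncPotential_of_integrable` asks continuity of the density only for the
measurability of the integrands, which here comes from `F ∈ L¹` directly), and the derivative is
bounded by `A(1 + 2B) ε⁻³ ∫‖F‖ = 64 A (1 + 2B) δ⁻³ ∫‖F‖`.
-/

noncomputable section

open Set MeasureTheory Filter Topology Function Metric

namespace Summit.NavierStokesRegularity.NavierStokesRegularity.Theorems.BlowupIsLocallyDriven.Registered

open Literature.Analysis.FluidPDE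

-- The summit namespace `Summit.NavierStokesRegularity.NavierStokesRegularity.…` is fixed by the
-- route (problem and summit share the name), so the duplicated component is intended.
set_option linter.dupNamespace false

section TruncPotential

variable {V W : Type*} [NormedAddCommGroup V] [NormedSpace ℝ V] [NormedAddCommGroup W]
  [NormedSpace ℝ W]

/-- The regularised integrand `y ↦ K_ε(x − y) (f y)` is a.e. strongly measurable for an a.e.
strongly measurable density `f` (`K_ε` is continuous). [folklore] -/
theorem farSupportGrad_aestronglyMeasurable_truncKernel_sub_apply
    {K : EuclideanSpace ℝ (Fin 3) → V →L[ℝ] W} {A : ℝ} (hK : IsC1SingularKernel K A) {ε : ℝ}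
    (hε : 0 < ε) {f : EuclideanSpace ℝ (Fin 3) → V} (hf : AEStronglyMeasurable f volume)
    (x : EuclideanSpace ℝ (Fin 3)) :
    AEStronglyMeasurable (fun y => truncKernel K ε (x - y) (f y)) volume :=
  (isBoundedBilinearMap_apply (𝕜 := ℝ) (E := V) (F := W)).continuous.comp_aestronglyMeasurable₂
    (((contDiff_truncKernel hK hε).continuous.comp
      (continuous_const.sub continuous_id)).aestronglyMeasurable) hf

/-- The derivative integrand `y ↦ (∇K_ε(x − y) ·)(f y)` is a.e. strongly measurable for an a.e.
strongly measurable density `f` (`∇K_ε` is continuous). [folklore] -/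
theorem farSupportGrad_aestronglyMeasurable_fderiv_truncKernel_flip
    {K : EuclideanSpace ℝ (Fin 3) → V →L[ℝ] W} {A : ℝ} (hK : IsC1SingularKernel K A) {ε : ℝ}
    (hε : 0 < ε) {f : EuclideanSpace ℝ (Fin 3) → V} (hf : AEStronglyMeasurable f volume)
    (x : EuclideanSpace ℝ (Fin 3)) :
    AEStronglyMeasurable (fun y => (fderiv ℝ (truncKernel K ε) (x - y)).flip (f y)) volume := by
  have hDc : Continuous (fderiv ℝ (truncKernel K ε)) :=
    (contDiff_truncKernel hK hε).continuous_fderiv one_ne_zero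
  -- `(z, v) ↦ (∇K_ε z)ᵀ v` is jointly continuous; compose with `y ↦ (x - y, f y)`
  have hg : Continuous fun p : EuclideanSpace ℝ (Fin 3) × V =>
      (fderiv ℝ (truncKernel K ε) p.1).flip p.2 :=
    ((ContinuousLinearMap.flipₗᵢ ℝ (EuclideanSpace ℝ (Fin 3)) V W).continuous.comp
      (hDc.comp continuous_fst)).clm_apply continuous_snd
  have h := hg.comp_aestronglyMeasurable
    ((continuous_const.sub continuous_id).aestronglyMeasurable.prodMk hf : AEStronglyMeasurable
      (fun y : EuclideanSpace ℝ (Fin 3) => (x - y, f y)) volume)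
  exact h

/-- **The regularised potential of an integrable density is differentiable, with derivative under
the integral sign**: `∇(∫ K_ε(x − y) f(y) dy)(x₀) = ∫ (∇K_ε(x₀ − y) ·)(f y) dy` for `f ∈ L¹`
(dominated differentiation: `‖(∇K_ε(x − y) ·)(f y)‖ ≤ A(1+2B)ε⁻³ ‖f y‖ ∈ L¹`; the tree's
`hasFDerivAt_truncPotential_of_integrable` without the continuity of `f`;
Gilbarg–Trudinger §4.1, proof of Lemma 4.1). [folklore] -/
theorem farSupportGrad_hasFDerivAt_truncPotential
    {K : EuclideanSpace ℝ (Fin 3) → V →L[ℝ] W} {A : ℝ} (hK : IsC1SingularKernel K A) {ε : ℝ}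
    (hε : 0 < ε) {f : EuclideanSpace ℝ (Fin 3) → V} (hfi : Integrable f)
    (x₀ : EuclideanSpace ℝ (Fin 3)) :
    HasFDerivAt (truncPotential K ε f)
      (∫ y, (fderiv ℝ (truncKernel K ε) (x₀ - y)).flip (f y)) x₀ := by
  -- adapted from `hasFDerivAt_truncPotential_of_integrable` (BiotSavartDivCurl.lean)
  obtain ⟨B, hB0, hB⟩ := exists_norm_fderiv_radialCutoff_le
  set C : ℝ := A * (1 + 2 * B) * (ε ^ 3)⁻¹ with hC
  have hcont : ContDiff ℝ 1 (truncKernel K ε) := contDiff_truncKernel hK hε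
  unfold truncPotential
  refine hasFDerivAt_integral_of_dominated_of_fderiv_le (𝕜 := ℝ) (μ := volume) (s := univ)
    (F := fun x y => truncKernel K ε (x - y) (f y))
    (F' := fun x y => (fderiv ℝ (truncKernel K ε) (x - y)).flip (f y))
    (bound := fun y => C * ‖f y‖) univ_mem ?_ ?_ ?_ ?_ ?_ ?_
  · exact Eventually.of_forall fun x =>
      farSupportGrad_aestronglyMeasurable_truncKernel_sub_apply hK hε hfi.aestronglyMeasurable x
  · refine (hfi.norm.const_mul (A * (ε ^ 2)⁻¹)).mono'
      (farSupportGrad_aestronglyMeasurable_truncKernel_sub_apply hK hε hfi.aestronglyMeasurable x₀)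
      (Eventually.of_forall fun y => ?_)
    calc ‖truncKernel K ε (x₀ - y) (f y)‖ ≤ ‖truncKernel K ε (x₀ - y)‖ * ‖f y‖ :=
          ContinuousLinearMap.le_opNorm _ _
      _ ≤ A * (ε ^ 2)⁻¹ * ‖f y‖ := by
          gcongr
          exact norm_truncKernel_le_const hK hε (x₀ - y)
  · exact farSupportGrad_aestronglyMeasurable_fderiv_truncKernel_flip hK hε
      hfi.aestronglyMeasurable x₀
  · refine Eventually.of_forall fun y x _ => ?_
    calc ‖(fderiv ℝ (truncKernel K ε) (x - y)).flip (f y)‖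
        ≤ ‖(fderiv ℝ (truncKernel K ε) (x - y)).flip‖ * ‖f y‖ := ContinuousLinearMap.le_opNorm _ _
      _ = ‖fderiv ℝ (truncKernel K ε) (x - y)‖ * ‖f y‖ := by rw [ContinuousLinearMap.opNorm_flip]
      _ ≤ C * ‖f y‖ := by
          gcongr
          exact norm_fderiv_truncKernel_le_const hK hB0 hB hε (x - y)
  · exact hfi.norm.const_mul C
  · refine Eventually.of_forall fun y x _ => ?_
    have h1 : HasFDerivAt (truncKernel K ε) (fderiv ℝ (truncKernel K ε) (x - y)) (x - y) :=
      ((hcont.differentiable one_ne_zero) _).hasFDerivAt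
    have h2 : HasFDerivAt (fun x : EuclideanSpace ℝ (Fin 3) => x - y)
        (ContinuousLinearMap.id ℝ (EuclideanSpace ℝ (Fin 3))) x :=
      (hasFDerivAt_id x).sub_const y
    have h3 := h1.comp x h2
    have h4 := h3.clm_apply (hasFDerivAt_const (f y) x)
    refine h4.congr_fderiv ?_
    ext e
    simp

/-- **Size of the derivative of the regularised potential**:
`‖∫ (∇K_ε(x₀ − y) ·)(f y) dy‖ ≤ A(1 + 2B) ε⁻³ ∫ ‖f‖` for `f ∈ L¹`, where `B` is the universal
constant of the scaled cutoff (`exists_norm_fderiv_radialCutoff_le`). [folklore] -/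
theorem farSupportGrad_norm_integral_fderiv_truncKernel_flip_le
    {K : EuclideanSpace ℝ (Fin 3) → V →L[ℝ] W} {A : ℝ} (hK : IsC1SingularKernel K A) {B : ℝ}
    (hB0 : 0 ≤ B)
    (hB : ∀ ε : ℝ, 0 < ε → ∀ z : EuclideanSpace ℝ (Fin 3),
      ‖fderiv ℝ (radialCutoff ε (2 * ε)) z‖ ≤ B * ε⁻¹)
    {ε : ℝ} (hε : 0 < ε) {f : EuclideanSpace ℝ (Fin 3) → V} (hfi : Integrable f)
    (x₀ : EuclideanSpace ℝ (Fin 3)) :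
    ‖∫ y, (fderiv ℝ (truncKernel K ε) (x₀ - y)).flip (f y)‖ ≤
      A * (1 + 2 * B) * (ε ^ 3)⁻¹ * ∫ y, ‖f y‖ := by
  have hpt : ∀ y, ‖(fderiv ℝ (truncKernel K ε) (x₀ - y)).flip (f y)‖ ≤
      A * (1 + 2 * B) * (ε ^ 3)⁻¹ * ‖f y‖ := fun y =>
    calc ‖(fderiv ℝ (truncKernel K ε) (x₀ - y)).flip (f y)‖
        ≤ ‖(fderiv ℝ (truncKernel K ε) (x₀ - y)).flip‖ * ‖f y‖ := ContinuousLinearMap.le_opNorm _ _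
      _ = ‖fderiv ℝ (truncKernel K ε) (x₀ - y)‖ * ‖f y‖ := by rw [ContinuousLinearMap.opNorm_flip]
      _ ≤ A * (1 + 2 * B) * (ε ^ 3)⁻¹ * ‖f y‖ := by
          gcongr
          exact norm_fderiv_truncKernel_le_const hK hB0 hB hε (x₀ - y)
  calc ‖∫ y, (fderiv ℝ (truncKernel K ε) (x₀ - y)).flip (f y)‖
      ≤ ∫ y, ‖(fderiv ℝ (truncKernel K ε) (x₀ - y)).flip (f y)‖ := norm_integral_le_integral_norm _
    _ ≤ ∫ y, A * (1 + 2 * B) * (ε ^ 3)⁻¹ * ‖f y‖ :=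
        integral_mono_of_nonneg (Eventually.of_forall fun y => norm_nonneg _)
          (hfi.norm.const_mul _) (Eventually.of_forall hpt)
    _ = A * (1 + 2 * B) * (ε ^ 3)⁻¹ * ∫ y, ‖f y‖ := integral_const_mul _ _

end TruncPotential

/-! ### The Biot–Savart velocity of a field vanishing on a ball -/

/-- **Near the centre of a vorticity-free ball the Biot–Savart integral is a regularised
potential**: if `F = 0` on `B(x, δ)`, then for `z ∈ B(x, δ/2)` every `y` has either `F y = 0` or
`|z − y| ≥ δ/2`, where the truncated kernel `K_{δ/4}` agrees with `K₃`; hence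
`biotSavart F = truncPotential biotSavartCLM (δ/4) F` on `B(x, δ/2)`. [folklore] -/
theorem farSupportGrad_biotSavart_eventuallyEq_truncPotential
    {F : EuclideanSpace ℝ (Fin 3) → EuclideanSpace ℝ (Fin 3)} {x : EuclideanSpace ℝ (Fin 3)} {δ : ℝ}
    (hδ : 0 < δ) (hF0 : ∀ y ∈ ball x δ, F y = 0) :
    biotSavart F =ᶠ[𝓝 x] truncPotential biotSavartCLM (δ / 4) F := by
  filter_upwards [ball_mem_nhds x (half_pos hδ)] with z hz
  simp only [biotSavart, truncPotential]
  refine integral_congr_ae (Eventually.of_forall fun y => ?_)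
  beta_reduce
  by_cases hy : y ∈ ball x δ
  · simp [hF0 y hy]
  · have hfar : 2 * (δ / 4) ≤ ‖z - y‖ := by
      rw [mem_ball, dist_eq_norm] at hz
      rw [mem_ball, dist_eq_norm, not_lt] at hy
      have h := norm_sub_le_norm_sub_add_norm_sub y z x
      rw [norm_sub_rev y z] at h
      linarith
    rw [truncKernel_eq biotSavartCLM (by positivity) hfar, biotSavartCLM_apply]

/-- **stub F1 — `stub_farSupportGrad` (potential theory).** If an integrable field `F` vanishes on
the ball `B(x,δ)`, its Biot–Savart velocity `biotSavart F` is differentiable at the centre `x`,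
with `‖∇(biotSavart F)(x)‖ ≤ A δ⁻³ ∫‖F‖` for an absolute constant `A` (near `x` the velocity is
the regularised potential `∫ K_{δ/4}(· − y) F(y) dy` of the smoothly truncated Biot–Savart kernel,
which is differentiated under the integral sign with `‖∇K_{δ/4}‖ ≤ A'(1 + 2B)(δ/4)⁻³`;
Majda–Bertozzi (4.30)–(4.31) for the kernel bounds, Gilbarg–Trudinger §4.1 Lemma 4.1 for the
regularised potential). [folklore] -/
theorem stub_farSupportGrad :
    ∃ A : ℝ, 0 ≤ A ∧ ∀ (F : EuclideanSpace ℝ (Fin 3) → EuclideanSpace ℝ (Fin 3)) (x : EuclideanSpace ℝ (Fin 3)) (δ : ℝ),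
      0 < δ → MeasureTheory.Integrable F MeasureTheory.volume →
      (∀ y ∈ Metric.ball x δ, F y = 0) →
      DifferentiableAt ℝ (Literature.Analysis.FluidPDE.biotSavart F) x ∧
        ‖fderiv ℝ (Literature.Analysis.FluidPDE.biotSavart F) x‖ ≤ A * (δ ^ 3)⁻¹ * ∫ y, ‖F y‖ := by
  obtain ⟨A, hK⟩ := exists_isC1SingularKernel_biotSavartCLM
  obtain ⟨B, hB0, hB⟩ := exists_norm_fderiv_radialCutoff_le
  have hA : 0 ≤ A := hK.nonneg
  refine ⟨64 * (A * (1 + 2 * B)), by positivity, fun F x δ hδ hFi hF0 => ?_⟩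
  have hε : 0 < δ / 4 := by positivity
  have hD : HasFDerivAt (biotSavart F)
      (∫ y, (fderiv ℝ (truncKernel biotSavartCLM (δ / 4)) (x - y)).flip (F y)) x :=
    (farSupportGrad_hasFDerivAt_truncPotential hK hε hFi x).congr_of_eventuallyEq
      (farSupportGrad_biotSavart_eventuallyEq_truncPotential hδ hF0)
  refine ⟨hD.differentiableAt, ?_⟩
  rw [hD.fderiv]
  calc ‖∫ y, (fderiv ℝ (truncKernel biotSavartCLM (δ / 4)) (x - y)).flip (F y)‖
      ≤ A * (1 + 2 * B) * ((δ / 4) ^ 3)⁻¹ * ∫ y, ‖F y‖ :=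
        farSupportGrad_norm_integral_fderiv_truncKernel_flip_le hK hB0 hB hε hFi x
    _ = 64 * (A * (1 + 2 * B)) * (δ ^ 3)⁻¹ * ∫ y, ‖F y‖ := by
        have h64 : ((δ / 4) ^ 3)⁻¹ = 64 * (δ ^ 3)⁻¹ := by
          rw [div_pow, inv_div, mul_comm, ← div_eq_inv_mul]
          norm_num
        rw [h64]
        ring

end Summit.NavierStokesRegularity.NavierStokesRegularity.Theorems.BlowupIsLocallyDriven.Registered
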